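import Literature.Probability.LatticeModels.MedialCycleSeparation
import HarnessLib

/-!
# Dual steps over closed edges do not cross the closed perturbed polygon of a cycle

Topic: `Summits/CriticalPhenomena/CardyFormulaZ2`. For the crux `LagHandOff` (line
hitting-tournament, touch criterion): the dual twin of `wind_cyLoop_eq_of_mem` /
`wind_cyLoop_eq_of_reachable` of `MedialCycleSeparation.lean`. The centre segment
`centerSeg f f'` of two adjacent faces (the geometric dual edge) meets the closed perturbed
polygon `cyLoop n h` of a cycle of the turning rule `nextCorner β` only along a face connector,
whose followed edge is *open* and is the primal edge `dualDartEdge f f'` crossed by the dual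
edge; so if that edge is closed the two face centres have the same winding number (A1), and the
winding number is constant along walks of the dual-open graph `openGraph (dualConfig β)` (A2).
-/

noncomputable section

open Set Complex Literature.Topology.PlaneTopology
open Literature.Probability.Percolation Literature.Probability.LatticeModels

namespace Summit.CriticalPhenomena.CardyFormulaZ2.Cruxes.LagHandOff.HittingTournament

/-- **A connector meets the centre segment of two adjacent faces only at a face turn whose
followed (open) edge separates the two faces**: vertex connectors miss every centre segment
(`VConnShape.not_mem_centerSeg`); a face connector runs `1/8` inside its face along the
followed edge `cTgt (orb m) = {v_m, v_{m+1}}`, and `FConnShape.centerSeg_faces` identifies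
`{f, f'}` with the two faces on either side of that edge, i.e. `dualEdge (cTgt (orb m)) =
{f, f'}` (`IsMedialExploration.dualEdge_eq_of_coords`). -/
theorem dualEdge_cTgt_eq_of_mem_cyConn {β : BondConfig (Site 2)} {q : Site 2 × Fin 4} (m : ℕ)
    {f f' : Site 2} (hff' : (zdGraph 2).Adj f f') {z : ℂ} (hz : z ∈ cyConn β q m)
    (hz' : z ∈ centerSeg f f') :
    cTgt (cornerOrbit β q m) ∈ β ∧ dualEdge (cTgt (cornerOrbit β q m)) = s(f, f') := by
  rcases cyConn_cases m hz with ⟨I, J, -, -, -, -, -, -, hshape⟩ | ⟨-, -, -, ho, -⟩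
  · exact absurd hz' (hshape.not_mem_centerSeg hff')
  · rcases cy_turn_cases (β := β) (q := q) m with ⟨hc, -, -, -⟩ | ⟨-, hf, hv, he⟩
    · exact absurd ho hc
    · refine ⟨ho, ?_⟩
      have hc1 : IsCorner (cyV β q m) (cyF β q m) := isCorner_cy m
      have he' : cornerTarget (cyV β q m) (cyF β q m) = cornerSource (cyV β q (m + 1)) (cyF β q m) := he
      obtain ⟨hdir, hsum, hoth⟩ := faceTurn_dirs hv.symm he'
      set I := tgtDir (cyV β q m) (cyF β q m)
      obtain ⟨J, hJI⟩ := exists_ne I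
      have hothJ : cyV β q m J = cyV β q (m + 1) J := hoth J hJI
      have hzz : z ∈ segment ℝ (dartPt (cyV β q m) (cyF β q m) I)
          (dartPt (cyV β q (m + 1)) (cyF β q m) I) := by
        have : cyS β q (m + 1) = dartPt (cyV β q (m + 1)) (cyF β q m) I := by rw [cyS, hf, hdir]
        rw [cyConn, cyT, this] at hz
        exact hz
      obtain ⟨hshape, h1, h2⟩ := fConn_shape hc1 hJI hsum hothJ hzz
      obtain ⟨hfI, hf'I, hfgJ⟩ := hshape.centerSeg_faces (L := cyV β q m J) h1 h2 hff' hz'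
      -- the followed edge joins the two consecutive vertices of the cycle
      have h12 : cTgt (cornerOrbit β q m) = s(cyV β q m, cyV β q (m + 1)) := by
        rw [cyV, cyV, show cornerOrbit β q (m + 1) = nextCorner β (cornerOrbit β q m) from rfl,
          nextCorner_of_mem ho, cTgt]
      rw [h12]
      rcases hc1 I with hvI | hvI
      · -- `v_m I = F I`, `v_{m+1} I = F I + 1`
        refine IsMedialExploration.dualEdge_eq_of_coords hJI hothJ.symm (by omega) (by omega)
          (by omega) ?_
        rcases hfgJ with ⟨h3, h4⟩ | ⟨h3, h4⟩
        · exact Or.inl ⟨by omega, by omega⟩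
        · exact Or.inr ⟨by omega, by omega⟩
      · -- `v_m I = F I + 1`, `v_{m+1} I = F I`: swap the endpoints
        rw [Sym2.eq_swap]
        refine IsMedialExploration.dualEdge_eq_of_coords hJI hothJ (by omega) (by omega)
          (by omega) ?_
        rcases hfgJ with ⟨h3, h4⟩ | ⟨h3, h4⟩
        · exact Or.inl ⟨by omega, by omega⟩
        · exact Or.inr ⟨by omega, by omega⟩

/-- **Dual edges over closed primal edges miss the polygon.** If `f`, `f'` are adjacent faces
and the crossed primal edge `dualDartEdge f f'` is closed, the centre segment `centerSeg f f'`
misses the closed perturbed polygon of every cycle: dart pieces miss all centre segments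
(`dartSeg_inter_centerSeg`), and a connector meeting it would make `dualDartEdge f f'` the
followed open edge (`dualEdge_cTgt_eq_of_mem_cyConn`, `dualEdge_dualDartEdge_holds`,
injectivity of `dualEdge`). -/
theorem centerSeg_disjoint_range_cyLoop {β : BondConfig (Site 2)} {q : Site 2 × Fin 4} {n : ℕ}
    (h : cornerOrbit β q (n + 1) = q) {f f' : Site 2} (hff' : (zdGraph 2).Adj f f')
    (hclosed : dualDartEdge f f' ∉ β) {z : ℂ} (hz : z ∈ centerSeg f f') :
    z ∉ range (cyLoop n h) := by
  refine not_mem_range_cyLoop h (fun j _ hzj => ?_) (fun j _ hzj => ?_)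
  · rw [cyDart_eq] at hzj
    exact dartSeg_inter_centerSeg (isCorner_cy j) hff' hzj hz
  · obtain ⟨ho, hdual⟩ := dualEdge_cTgt_eq_of_mem_cyConn j hff' hzj hz
    have : cTgt (cornerOrbit β q j) = dualDartEdge f f' :=
      dualEdge_bijective.1 (hdual.trans (dualEdge_dualDartEdge_holds hff').symm)
    exact hclosed (this ▸ ho)

/-- **A1: winding is unchanged across a dual step over a closed lattice edge.** For a cycle of
the turning rule (period `n + 1` through `q`) and adjacent faces `f`, `f'` whose common primal
edge `dualDartEdge f f'` is closed, the centres of `f` and `f'` have the same winding number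
with respect to the closed perturbed polygon `cyLoop n h` (they are joined by the centre
segment, which misses the polygon: `wind_cyLoop_eq_of_segment`). -/
theorem stub_touch_wind_faceCenter_eq_of_adj :
    ∀ (β : BondConfig (Site 2)), β ⊆ (zdGraph 2).edgeSet → ∀ (q : Site 2 × Fin 4) (n : ℕ)
      (h : cornerOrbit β q (n + 1) = q) (f f' : Site 2), (zdGraph 2).Adj f f' → dualDartEdge f f' ∉ β →
      wind (fun t => (cyLoop n h).extend t - faceCenter f) = wind (fun t => (cyLoop n h).extend t - faceCenter f') := by
  intro β _ q n h f f' hff' hclosed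
  exact wind_cyLoop_eq_of_segment h fun z hz => centerSeg_disjoint_range_cyLoop h hff' hclosed hz

/-- **A2: winding is constant along dual-open (closed-edge) walks of faces.** Along a walk of the
dual-open graph `openGraph (dualConfig β)` each step `f → f'` is a lattice adjacency of faces
whose crossed primal edge `dualDartEdge f f'` is closed (`mem_dualConfig_iff`,
`dualEdge_dualDartEdge_holds`), so A1 applies step by step. -/
theorem stub_touch_wind_faceCenter_eq_of_dualReachable :
    ∀ (β : BondConfig (Site 2)), β ⊆ (zdGraph 2).edgeSet → ∀ (q : Site 2 × Fin 4) (n : ℕ)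
      (h : cornerOrbit β q (n + 1) = q) (f f' : Site 2), (openGraph (dualConfig β)).Reachable f f' →
      wind (fun t => (cyLoop n h).extend t - faceCenter f) = wind (fun t => (cyLoop n h).extend t - faceCenter f') := by
  intro β hβ q n h f f' hreach
  obtain ⟨p⟩ := hreach
  induction p with
  | nil => rfl
  | cons hadj _ ih =>
    rw [openGraph_adj, mem_dualConfig_iff] at hadj
    obtain ⟨⟨hedge, hdual⟩, -⟩ := hadj
    have hadj' : (zdGraph 2).Adj _ _ := hedge
    exact (stub_touch_wind_faceCenter_eq_of_adj β hβ q n h _ _ hadj'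
      (fun hmem => hdual _ hmem (dualEdge_dualDartEdge_holds hadj'))).trans ih

end Summit.CriticalPhenomena.CardyFormulaZ2.Cruxes.LagHandOff.HittingTournament

end
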